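import Summits.QuantumFields.BalabanUV.Beta.WilsonJetReflection
import Summits.QuantumFields.BalabanUV.Beta.WilsonReflectionFrame

/-!
# The reflection law, with contact, of the antisymmetrised Wilson stencil under an axis reflection

HONEST FRAMING.  Discharging `BetaPertH` makes Balaban's ultraviolet stability UNCONDITIONAL — a real constructive-QFT
result; it is NOT the continuum limit and NOT the Clay problem.  This leaf is bookkeeping toward the Wilson piece of the
background-covariance-with-contact of the one-step jet (cell pub-balaban, β sub-cell, lane an3; demand X-an2-45 §3 (ii)):
finite-dimensional linear algebra over an arbitrary finite abelian lattice, no estimate, no limit, nothing cited —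
every statement is kernel-proved here ([folklore] = standard finite algebra, no published theorem is being quoted).

THE CHAIN.  `WilsonJetReflection.jet21_pull` (the jet law with contact under the pull-back `pull σ e α`) is read, for the
coordinate field `W = field t v` and the one-bond background `B = bondLetter u κ′ Y`, through
`PlaquetteStencil.actionJet21_eq_wilsonVertex₁` on both sides: since `pull (field t v) = field t (pullv v)` (`pull_field`) and
`pull (bondLetter u κ′ Y) = bondLetter (rsite u) κ′ (sgn α κ′ • Y)` (`pull_bondLetter`), and since the contact sum evaluates in
coordinates to `[κ′ = α] · (−ctF e α u (adM Y) v)` (`contact_field_bondLetter`), one gets the QUADRATIC-FORM LAW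
(`quadratic_law`): `sgn α κ′ · (pullv v) ⬝ᵥ W(rsite u, κ′, adM Y) (pullv v) = v ⬝ᵥ W(u, κ′, adM Y) v + [κ′ = α]·2·ctF`.
Evaluating at `v = cvec a δ_p + cvec b δ_q` (`WilsonReflectionFrame`) gives the ENTRYWISE LAW WITH COLOUR (`entry_law_colour`,
a multiple of `(adM Y)_{ab}`), and a non-degenerate witness in the real quaternions `ℍ` (`adM_witnessH`: letters `i, j`, background `−½k`, functional `re`;
`ℍ` carries library `NormedRing` ∕ `NormedAlgebra ℝ` instances, so no local instance is introduced) strips the colour: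

`S₀A_reflect`: on every finite abelian lattice with frame `e` and every involution `σ` obeying the frame laws,
`S₀A(rsite u, κ′; rpt p, rpt q) = sgn α κ′ · sgn α p.2 · sgn α q.2 · (S₀A(u, κ′; p, q) + [κ′ = α]·(Lc p·[q = (u,α)] − Lc q·[p = (u,α)]))`.

This is the finite-torus form of the Wilson law WITH CONTACT asked for in X-an2-45 §3 (ii) ∕ (R45-4); the transfer to `ℤ^(d+1)`
and the identification of `Lc` with an2's `DiagonalContact` tables is the next leaf (not here).
-/

namespace Summit.QuantumFields.BalabanUV.Beta.WilsonStencilReflection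

open Literature.MathematicalPhysics.QuantumFieldTheory.Balaban1983to89.Beta.SpinTable (br)
open Literature.MathematicalPhysics.QuantumFieldTheory.Balaban1983to89.Beta.PlaquetteVertex
open Literature.MathematicalPhysics.QuantumFieldTheory.Balaban1983to89.Beta.PlaquetteStencil (wilsonVertex₁
  actionJet21_eq_wilsonVertex₁)
open Literature.MathematicalPhysics.QuantumFieldTheory.Balaban1983to89.Beta.WilsonVertexKron (wilsonStencil₀
  wilsonVertex₁_apply_eq_mul)
open Summit.QuantumFields.BalabanUV.Beta.WilsonJetReflection (pull axComm jet21_pull)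
open Summit.QuantumFields.BalabanUV.Beta.WilsonReflectionFrame
open scoped Matrix

/-! ## §1 The pull-back in coordinates -/

section Coordinates

variable {𝔸 : Type*} [Ring 𝔸] [Algebra ℝ 𝔸]
variable {Λ : Type*} [AddCommGroup Λ] [DecidableEq Λ] {C : Type*} [Fintype C] {D : Type*} [Fintype D] [DecidableEq D]
variable {σ : Λ → Λ} {e : D → Λ} {α : D}

omit [DecidableEq Λ] [Fintype C] [Fintype D] in
/-- the pull-back entrywise, as a signed evaluation at the reflected bond. [folklore] -/
theorem pull_apply (X : Λ → D → 𝔸) (x : Λ) (κ : D) : pull σ e α X x κ = sgn α κ • X (rsite σ e α κ x) κ := by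
  unfold pull rsite sgn
  split_ifs with h
  · subst h; rw [neg_one_smul]
  · rw [one_smul, sub_zero]

omit [DecidableEq Λ] [Fintype D] in
/-- **THE REFLECTION OF THE COORDINATE FIELD IS THE COORDINATE FIELD OF THE REFLECTED COORDINATES.** [folklore] -/
theorem pull_field (t : C → 𝔸) (v : Λ × (C × D) → ℝ) : pull σ e α (field t v) = field t (pullv σ e α v) := by
  funext x κ
  rw [pull_apply]
  simp only [field, pullv, Finset.smul_sum, smul_smul]

omit [Fintype C] [Fintype D] in
/-- **THE REFLECTION OF THE ONE-BOND BACKGROUND IS THE ONE-BOND BACKGROUND AT THE REFLECTED BOND, LETTER `±Y`.** [folklore] -/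
theorem pull_bondLetter (hσ : Function.Involutive σ) (h₂ : ∀ x, σ (x + e α) = σ x - e α) (u : Λ) (κ' : D) (Y : 𝔸) :
    pull σ e α (bondLetter u κ' Y) = bondLetter (rsite σ e α κ' u) κ' (sgn α κ' • Y) := by
  funext x κ
  rw [pull_apply]
  simp only [bondLetter, smul_ite, smul_zero, rsite_eq_iff hσ h₂]
  by_cases hk : κ = κ'
  · subst hk; rfl
  · rw [if_neg (fun h => hk h.2), if_neg (fun h => hk h.2)]

end Coordinates

/-! ## §2 The contact of `WilsonJetReflection.jet21_pull` in coordinates and the quadratic-form law -/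

section Contact

variable {𝔸 : Type*} [NormedRing 𝔸] [NormedAlgebra ℝ 𝔸]
variable {Λ : Type*} [Fintype Λ] [DecidableEq Λ] [AddCommGroup Λ] {C : Type*} [Fintype C] [DecidableEq C]
  {D : Type*} [Fintype D] [DecidableEq D] {σ : Λ → Λ} {e : D → Λ} {α : D}

omit [Fintype Λ] [AddCommGroup Λ] [DecidableEq C] [Fintype D] in
/-- the same-bond commutator letter of the coordinate field against the one-bond background: supported at the background bond,
value `[Y, W_α(u)]`. [folklore] -/
theorem axComm_field_bondLetter (t : C → 𝔸) (v : Λ × (C × D) → ℝ) (u : Λ) (κ' : D) (Y : 𝔸) (y : Λ) :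
    axComm (field t v) (bondLetter u κ' Y) α y = if y = u ∧ α = κ' then Y * field t v u α - field t v u α * Y else 0 := by
  unfold axComm bondLetter
  split_ifs with h
  · rw [h.1]
  · rw [zero_mul, mul_zero, sub_zero]

omit [Fintype Λ] [DecidableEq Λ] [AddCommGroup Λ] [DecidableEq C] [Fintype D] [DecidableEq D] in
/-- the trace of a coordinate combination against the commutator of the letter with another combination, in colour matrices:
`τ(G·(YF − FY)) = −Σ_a g_a · Σ_b (adM Y)_{ab} f_b` (tracial `τ`; `PlaquetteVertex.trace_mul_br_sum`, `adM_antisymm`). [folklore] -/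
theorem trace_comb_mul_comm (τ : 𝔸 →ₗ[ℝ] ℝ) (hτ : ∀ a b : 𝔸, τ (a * b) = τ (b * a)) (t : C → 𝔸) (Y : 𝔸) (g f : C → ℝ) :
    τ ((∑ a, g a • t a) * (Y * (∑ b, f b • t b) - (∑ b, f b • t b) * Y)) = -∑ a, g a * ∑ b, adM τ t Y a b * f b := by
  set G := ∑ a, g a • t a with hG
  set F := ∑ b, f b • t b with hF
  have h1 : G * (Y * F - F * Y) = G * Y * F - G * F * Y := by rw [mul_sub, ← mul_assoc, ← mul_assoc]
  rw [h1, map_sub, hτ (G * Y) F, ← mul_assoc, hτ (F * G) Y, hτ (G * F) Y, ← map_sub, ← mul_sub,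
    show F * G - G * F = br F G from rfl, hF, hG, trace_mul_br_sum, Finset.sum_comm, ← Finset.sum_neg_distrib]
  refine Finset.sum_congr rfl fun a _ => ?_
  rw [Finset.mul_sum, ← Finset.sum_neg_distrib]
  refine Finset.sum_congr rfl fun b _ => ?_
  rw [adM_antisymm τ t Y a b]
  ring

omit [DecidableEq C] in
/-- **THE CONTACT OF THE JET LAW IN COORDINATES**: for the coordinate field `W = field t v` and the one-bond background
`B = bondLetter u κ′ Y`, the contact sum of `WilsonJetReflection.jet21_pull` vanishes unless the background bond is parallel to the
reflected axis (`κ′ = α`), and then equals `−ctF e α u (adM Y) v`. [folklore] -/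
theorem contact_field_bondLetter (τ : 𝔸 →ₗ[ℝ] ℝ) (hτ : ∀ a b : 𝔸, τ (a * b) = τ (b * a)) (t : C → 𝔸)
    (v : Λ × (C × D) → ℝ) (u : Λ) (κ' : D) (Y : 𝔸) :
    ∑ y, ∑ ν, τ (lcurl e (field t v) y ν α *
        (axComm (field t v) (bondLetter u κ' Y) α (y + e ν) - axComm (field t v) (bondLetter u κ' Y) α y)) =
      if α = κ' then -ctF e α u (adM τ t Y) v else 0 := by
  by_cases hκ : α = κ'
  · subst hκ
    rw [if_pos rfl]
    simp only [axComm_field_bondLetter, and_true]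
    set c₀ := Y * field t v u α - field t v u α * Y with hc₀
    have hite : ∀ (P : Prop) [Decidable P] (g : 𝔸), τ (g * (if P then c₀ else 0)) = if P then τ (g * c₀) else 0 := by
      intro P _ g; split_ifs <;> simp
    simp_rw [mul_sub, map_sub, hite, Finset.sum_sub_distrib]
    have hA : (∑ y, ∑ ν, if y + e ν = u then τ (lcurl e (field t v) y ν α * c₀) else 0) =
        ∑ ν, τ (lcurl e (field t v) (u - e ν) ν α * c₀) := by
      rw [Finset.sum_comm]
      refine Finset.sum_congr rfl fun ν _ => ?_
      simp_rw [← eq_sub_iff_add_eq]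
      rw [Finset.sum_ite_eq' Finset.univ (u - e ν), if_pos (Finset.mem_univ _)]
    have hB : (∑ y, ∑ ν, if y = u then τ (lcurl e (field t v) y ν α * c₀) else 0) =
        ∑ ν, τ (lcurl e (field t v) u ν α * c₀) := by
      rw [Finset.sum_comm]
      refine Finset.sum_congr rfl fun ν _ => ?_
      rw [Finset.sum_ite_eq' Finset.univ u, if_pos (Finset.mem_univ _)]
    rw [hA, hB, ← Finset.sum_sub_distrib]
    simp_rw [lcurl_field, hc₀]
    simp only [field]
    simp_rw [trace_comb_mul_comm τ hτ t Y]
    have hswap : ∀ g : D → C → ℝ, (∑ ν, ∑ a, g ν a * ∑ b, adM τ t Y a b * v (u, (b, α))) =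
        ∑ a, ∑ ν, g ν a * ∑ b, adM τ t Y a b * v (u, (b, α)) := fun g => Finset.sum_comm
    simp only [ctF, Finset.sum_mul, sub_mul, Finset.sum_sub_distrib, Finset.sum_neg_distrib, hswap]
    ring
  · rw [if_neg hκ]
    refine Finset.sum_eq_zero fun y _ => Finset.sum_eq_zero fun ν _ => ?_
    rw [axComm_field_bondLetter, axComm_field_bondLetter, if_neg (fun h => hκ h.2), if_neg (fun h => hκ h.2), sub_zero, mul_zero,
      map_zero]

/-- **THE QUADRATIC-FORM LAW OF THE REFLECTION.**  For every finite lattice, frame, axis involution `σ` (frame laws `h₁`, `h₂`),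
every normed algebra, tracial `τ`, letter family `t`, background letter `Y` at the bond `(u, κ′)` and every fluctuation `v` in
coordinates: `sgn α κ′ · (pullv v) ⬝ᵥ W(u′, κ′, adM Y) (pullv v) = v ⬝ᵥ W(u, κ′, adM Y) v + [κ′ = α]·2·ctF e α u (adM Y) v`
(`W = PlaquetteStencil.wilsonVertex₁`, `u′ = rsite σ e α κ′ u`) — the jet law `WilsonJetReflection.jet21_pull` read through
`PlaquetteStencil.actionJet21_eq_wilsonVertex₁` on both sides. [folklore] -/
theorem quadratic_law (τ : 𝔸 →ₗ[ℝ] ℝ) (hτ : ∀ a b : 𝔸, τ (a * b) = τ (b * a)) (hσ : Function.Involutive σ)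
    (h₁ : ∀ x κ, κ ≠ α → σ (x + e κ) = σ x + e κ) (h₂ : ∀ x, σ (x + e α) = σ x - e α) (t : C → 𝔸) (Y : 𝔸) (u : Λ) (κ' : D)
    (v : Λ × (C × D) → ℝ) :
    sgn α κ' * (pullv σ e α v ⬝ᵥ (wilsonVertex₁ e (rsite σ e α κ' u) κ' (adM τ t Y) *ᵥ pullv σ e α v)) =
      v ⬝ᵥ (wilsonVertex₁ e u κ' (adM τ t Y) *ᵥ v) + (if α = κ' then 2 * ctF e α u (adM τ t Y) v else 0) := by
  have hj := jet21_pull ℝ τ hτ hσ h₁ h₂ (field t v) (bondLetter u κ' Y)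
  rw [pull_field, pull_bondLetter hσ h₂, contact_field_bondLetter τ hτ] at hj
  have hL := actionJet21_eq_wilsonVertex₁ τ hτ t e (pullv σ e α v) (rsite σ e α κ' u) κ' (sgn α κ' • Y)
  rw [adM_smul, wilsonVertex₁_smul, Matrix.smul_mulVec, dotProduct_smul, smul_eq_mul, hj] at hL
  have hR := actionJet21_eq_wilsonVertex₁ τ hτ t e v u κ' Y
  by_cases hκ : α = κ'
  · rw [if_pos hκ] at hL ⊢
    rw [smul_neg, smul_eq_mul] at hL
    linarith
  · rw [if_neg hκ] at hL ⊢
    rw [smul_zero, add_zero] at hL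
    linarith

/-! ## §3 The entrywise law: with colour, then colourless -/

/-- **THE ENTRYWISE LAW WITH COLOUR.**  For every instance of §4 and all colours `a b` and bonds `p q`:
`(adM Y)_{ab} · sgn α κ′ · sgn α p.2 · sgn α q.2 · S₀A(u′,κ′; rpt p, rpt q) = (adM Y)_{ab} · (S₀A(u,κ′; p, q) + [κ′ = α]·(Lc p·[q = (u,α)] −
Lc q·[p = (u,α)]))` — the quadratic-form law at `v = cvec a δ_p + cvec b δ_q` (the diagonal terms die by `adM_antisymm`). [folklore] -/
theorem entry_law_colour (τ : 𝔸 →ₗ[ℝ] ℝ) (hτ : ∀ a b : 𝔸, τ (a * b) = τ (b * a)) (hσ : Function.Involutive σ)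
    (h₁ : ∀ x κ, κ ≠ α → σ (x + e κ) = σ x + e κ) (h₂ : ∀ x, σ (x + e α) = σ x - e α) (t : C → 𝔸) (Y : 𝔸) (u : Λ) (κ' : D)
    (a b : C) (p q : Λ × D) :
    adM τ t Y a b * (sgn α κ' * sgn α p.2 * sgn α q.2 * S₀A e (rsite σ e α κ' u) κ' (rpt σ e α p) (rpt σ e α q)) =
      adM τ t Y a b * (S₀A e u κ' p q + (if α = κ' then
        Lc e α u p * (Pi.single q (1 : ℝ) : Λ × D → ℝ) (u, α) - Lc e α u q * (Pi.single p (1 : ℝ) : Λ × D → ℝ) (u, α) else 0)) := by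
  have h := quadratic_law τ hτ hσ h₁ h₂ t Y u κ' (cvec a (Pi.single p 1) + cvec b (Pi.single q 1))
  have haa : adM τ t Y a a = 0 := by have := adM_antisymm τ t Y a a; linarith
  have hbb : adM τ t Y b b = 0 := by have := adM_antisymm τ t Y b b; linarith
  have hba : adM τ t Y b a = -adM τ t Y a b := adM_antisymm τ t Y a b
  rw [ctF_cvec_add_cvec, Lfun_single, Lfun_single] at h
  simp only [pullv_add, pullv_cvec, pullv₀_single hσ h₂, Matrix.mulVec_add, dotProduct_add, add_dotProduct, cvec_wilsonVertex₁_cvec,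
    smul_single_dotProduct_mulVec_smul_single] at h
  have h1 : ∀ (S : Matrix (Λ × D) (Λ × D) ℝ) (p' q' : Λ × D),
      (Pi.single p' (1 : ℝ) : Λ × D → ℝ) ⬝ᵥ (S *ᵥ (Pi.single q' (1 : ℝ))) = S p' q' := by
    intro S p' q'
    rw [Matrix.mulVec_single_one, single_one_dotProduct, Matrix.col_apply]
  simp only [h1, haa, hbb, hba, zero_mul, zero_add, add_zero] at h
  unfold S₀A
  by_cases hκ : α = κ'
  · rw [if_pos hκ] at h ⊢
    linear_combination (1 / 2 : ℝ) * h
  · rw [if_neg hκ] at h ⊢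
    linear_combination (1 / 2 : ℝ) * h

end Contact

section Colourless

open Quaternion

/-- THE WITNESS LETTERS `t 0 = i`, `t 1 = j` of the real quaternions `ℍ` (a normed `ℝ`-algebra with its library instances — no local
instances are introduced).  A definition asserting nothing. [folklore] -/
noncomputable def tH : Fin 2 → ℍ[ℝ] := ![⟨0, 1, 0, 0⟩, ⟨0, 0, 1, 0⟩]

/-- THE WITNESS BACKGROUND LETTER `Y = −½ k` of `ℍ`.  A definition asserting nothing. [folklore] -/
noncomputable def YH : ℍ[ℝ] := ⟨0, 0, 0, -1 / 2⟩

/-- THE REAL PART of a quaternion as an `ℝ`-linear functional (Mathlib's `QuaternionAlgebra.reₗ`).  A definition asserting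
nothing. [folklore] -/
noncomputable def τH : ℍ[ℝ] →ₗ[ℝ] ℝ := QuaternionAlgebra.reₗ _ _ _

/-- the real part is tracial: `re (a b) = re (b a)`. [folklore] -/
theorem τH_comm (a b : ℍ[ℝ]) : τH (a * b) = τH (b * a) := by
  show (a * b).re = (b * a).re
  simp only [Quaternion.re_mul]; ring

/-- THE WITNESS IS NON-DEGENERATE: `adM(−½k)_{01} = re(−½k · (ij − ji)) = re(−k²) = 1`. [folklore] -/
theorem adM_witnessH : adM τH tH YH 0 1 = 1 := by
  rw [adM_apply]
  show (YH * br (tH 0) (tH 1)).re = 1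
  simp [tH, YH, br]
  norm_num

/-- **THE REFLECTION LAW OF THE ANTISYMMETRISED WILSON STENCIL (entrywise, colourless).**  On every finite abelian lattice `Λ` with
frame `e : D → Λ` and every involution `σ` obeying the frame laws (`σ(x + e_κ) = σ x + e_κ` for `κ ≠ α`, `σ(x + e_α) = σ x − e_α`), for
every background bond `(u, κ′)` and all bonds `p q`:
`S₀A(u′, κ′; rpt p, rpt q) = sgn α κ′ · sgn α p.2 · sgn α q.2 · (S₀A(u, κ′; p, q) + [κ′ = α]·(Lc(p)·[q = (u,α)] − Lc(q)·[p = (u,α)]))`,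
`u′ = rsite σ e α κ′ u` — the background-covariance-with-contact of the antisymmetric part of `WilsonVertexKron.wilsonStencil₀` under the
axis reflection.  Proof: `entry_law_colour` at the non-degenerate quaternion witness `adM_witnessH`. [folklore] -/
theorem S₀A_reflect {Λ : Type*} [Fintype Λ] [DecidableEq Λ] [AddCommGroup Λ] {D : Type*} [Fintype D] [DecidableEq D] {σ : Λ → Λ}
    {e : D → Λ} {α : D} (hσ : Function.Involutive σ) (h₁ : ∀ x κ, κ ≠ α → σ (x + e κ) = σ x + e κ)
    (h₂ : ∀ x, σ (x + e α) = σ x - e α) (u : Λ) (κ' : D) (p q : Λ × D) :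
    S₀A e (rsite σ e α κ' u) κ' (rpt σ e α p) (rpt σ e α q) =
      sgn α κ' * sgn α p.2 * sgn α q.2 * (S₀A e u κ' p q + (if α = κ' then
        Lc e α u p * (if (u, α) = q then 1 else 0) - Lc e α u q * (if (u, α) = p then 1 else 0) else 0)) := by
  have h := entry_law_colour τH τH_comm hσ h₁ h₂ tH YH u κ' 0 1 p q
  rw [adM_witnessH, one_mul, one_mul, Pi.single_apply, Pi.single_apply] at h
  have hs : sgn α κ' * sgn α p.2 * sgn α q.2 * (sgn α κ' * sgn α p.2 * sgn α q.2) = 1 := by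
    unfold sgn; split_ifs <;> norm_num
  calc S₀A e (rsite σ e α κ' u) κ' (rpt σ e α p) (rpt σ e α q)
      = sgn α κ' * sgn α p.2 * sgn α q.2 * (sgn α κ' * sgn α p.2 * sgn α q.2) *
          S₀A e (rsite σ e α κ' u) κ' (rpt σ e α p) (rpt σ e α q) := by rw [hs, one_mul]
    _ = sgn α κ' * sgn α p.2 * sgn α q.2 *
          (sgn α κ' * sgn α p.2 * sgn α q.2 * S₀A e (rsite σ e α κ' u) κ' (rpt σ e α p) (rpt σ e α q)) := by ring
    _ = _ := by rw [h]

end Colourless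

end Summit.QuantumFields.BalabanUV.Beta.WilsonStencilReflection
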